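import Summits.CriticalPhenomena.Ising3DConformalLimit.Theses.LocalisationClock
import HarnessLib

/-!
# Strategist census sketch — crux `LocalisationClock.ImryMaWindowNoise` (stmt-CriticalPhenomena-15883)

Seat `planner-cstrat-stmt-CriticalPhenomena-15883-b1-0` (crux-strategist before the lead), 2026-08-17.
This file only TYPES the signatures quoted in `STRATEGY-CENSUS.md` and kernel-checks that they
recompose the crux; it registers no line (see the census for why none of these switches has teeth).

* `Sig.WindowProfile` — the STRENGTHENING S⁺ (uniform shape bound `R_L(s) ≥ c·q(1-q)` on the whole
  clock, `q = P[m²]/σ_L²`, written division-free) and `ImryMaWindowNoise_of_profile : S⁺ → crux`.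
* `Sig.WindowAlignment` (A), `Sig.WindowNonSelfAveraging` (N), `Sig.WindowSpread` (W) — the best typed
  split (correlation coefficient ≤ −c₂ on a window; Aharony–Harris non-self-averaging of the clock
  rate `sd r ≥ c₁ E r`; spread of the squared polarisation `sd m² ≥ c₃ E m²`) and the sorry-free
  recomposition `ImryMaWindowNoise_of_ANW : (A) → (N) → (W) → crux` (Cov = Corr·sd·sd).
All functionals (`w, tilt, m, Af, r, P, σ2`) are the crux's verbatim `let` block.
-/

noncomputable section

namespace Summit.CriticalPhenomena.Ising3DConformalLimit.Cruxes.ImryMaWindowNoise.Census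

open scoped BigOperators Topology Manifold Classical MeasureTheory ProbabilityTheory Matrix InnerProductSpace ComplexConjugate ContinuousMap
open Filter Set Function TopologicalSpace MeasureTheory

/-- Real-arithmetic core of the (A)(N)(W) recomposition: `Cov ≤ -c₂·sd_r·sd_m`, `c₁|E r| ≤ sd_r`,
`c₃|E m²| ≤ sd_m` give `Cov ≤ -(c₂c₁c₃)·E r·E m²`. [folklore] -/
theorem cov_le_of_corr_sd {Cov Pr Pm Vr Vm c₁ c₂ c₃ : ℝ} (hc₁ : 0 < c₁) (hc₂ : 0 < c₂) (hc₃ : 0 < c₃)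
    (hA : Cov ≤ -(c₂ * (Real.sqrt Vr * Real.sqrt Vm))) (hN : c₁ * |Pr| ≤ Real.sqrt Vr)
    (hW : c₃ * |Pm| ≤ Real.sqrt Vm) : Cov ≤ -(c₂ * (c₁ * c₃) * (Pr * Pm)) := by
  have h0 : (c₁ * |Pr|) * (c₃ * |Pm|) ≤ Real.sqrt Vr * Real.sqrt Vm :=
    mul_le_mul hN hW (by positivity) (Real.sqrt_nonneg _)
  have h1 : c₁ * c₃ * (Pr * Pm) ≤ (c₁ * |Pr|) * (c₃ * |Pm|) := by
    calc c₁ * c₃ * (Pr * Pm) ≤ |c₁ * c₃ * (Pr * Pm)| := le_abs_self _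
      _ = (c₁ * |Pr|) * (c₃ * |Pm|) := by
          rw [abs_mul, abs_mul, abs_mul, abs_of_pos hc₁, abs_of_pos hc₃]; ring
  have h2 : c₂ * (c₁ * c₃ * (Pr * Pm)) ≤ c₂ * (Real.sqrt Vr * Real.sqrt Vm) :=
    mul_le_mul_of_nonneg_left (h1.trans h0) hc₂.le
  linarith

/-- Real-arithmetic core of `S⁺ → crux`: on the window `[σ²/3, 2σ²/3]` the profile factor
`E m²·(σ² − E m²)` is at least `σ⁴/9`. [folklore] -/
theorem profile_core {Cov Pr Pm S c : ℝ} (hc : 0 < c) (hS : 0 < S) (h1 : 1 / 3 * S ≤ Pm)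
    (h2 : Pm ≤ 2 / 3 * S) (key : Cov * S ^ 2 ≤ -(c * (Pm * (S - Pm)) * |Pr * Pm|)) :
    Cov ≤ -(c / 9 * (Pr * Pm)) := by
  have hq : 1 / 9 * S ^ 2 ≤ Pm * (S - Pm) := by
    nlinarith [mul_nonneg (sub_nonneg.2 h1) (sub_nonneg.2 h2), sq_nonneg S]
  have habs : Pr * Pm ≤ |Pr * Pm| := le_abs_self _
  have h3 : c * (1 / 9 * S ^ 2) * |Pr * Pm| ≤ c * (Pm * (S - Pm)) * |Pr * Pm| :=
    mul_le_mul_of_nonneg_right (mul_le_mul_of_nonneg_left hq hc.le) (abs_nonneg _)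
  have h4 : Cov * S ^ 2 ≤ -(c * (1 / 9 * S ^ 2) * |Pr * Pm|) := by linarith
  have hx : 0 ≤ (c / 9 * S ^ 2) * (|Pr * Pm| - Pr * Pm) :=
    mul_nonneg (by positivity) (sub_nonneg.2 habs)
  have hid : -(c * (1 / 9 * S ^ 2) * |Pr * Pm|) + (c / 9 * S ^ 2) * (|Pr * Pm| - Pr * Pm)
      = -(c / 9 * (Pr * Pm)) * S ^ 2 := by ring
  have h5 : Cov * S ^ 2 ≤ -(c / 9 * (Pr * Pm)) * S ^ 2 := by linarith
  have hS2 : 0 < S ^ 2 := by positivity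
  nlinarith [h5, hS2, mul_le_mul_of_nonneg_right h5 hS2.le]

/-! ## The signatures -/

namespace Sig

/-- (A) ALIGNMENT on a window: the correlation coefficient of the clock rate `r` and the squared
posterior polarisation `m²` under the planted law is `≤ -c₂` (written `Cov ≤ -c₂·sd_r·sd_m`). [folklore] -/
def WindowAlignment : Prop :=
  let βc : ℝ := Literature.Probability.LatticeModels.criticalBeta 3; let w : (L : ℕ) → (↥(Literature.Probability.LatticeModels.box 3 L) → ℤˣ) → ℝ := fun L τ => Literature.Probability.LatticeModels.plusExpect 3 βc 0 (fun σ => if (∀ x : ↥(Literature.Probability.LatticeModels.box 3 L), σ x = τ x) then 1 else 0); let tilt : (L : ℕ) → (↥(Literature.Probability.LatticeModels.box 3 L) → ℝ) → ((↥(Literature.Probability.LatticeModels.box 3 L) → ℤˣ) → ℝ) → ℝ := fun L y g => (∑ τ, w L τ * g τ * Real.exp (∑ x, y x * ((τ x : ℤ) : ℝ))) / (∑ τ, w L τ * Real.exp (∑ x, y x * ((τ x : ℤ) : ℝ))); let m : (L : ℕ) → (↥(Literature.Probability.LatticeModels.box 3 L) → ℝ) → ℝ := fun L y => tilt L y (fun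 τ => ∑ x, ((τ x : ℤ) : ℝ)); let Af : (L : ℕ) → (↥(Literature.Probability.LatticeModels.box 3 L) → ℝ) → ↥(Literature.Probability.LatticeModels.box 3 L) → ℝ := fun L y x => tilt L y (fun τ => ((τ x : ℤ) : ℝ) * ∑ x', ((τ x' : ℤ) : ℝ)) - tilt L y (fun τ => ((τ x : ℤ) : ℝ)) * m L y; let r : (L : ℕ) → (↥(Literature.Probability.LatticeModels.box 3 L) → ℝ) → ℝ := fun L y => ∑ x, Af L y x ^ 2; let P : (L : ℕ) → ℝ → ((↥(Literature.Probability.LatticeModels.box 3 L) → ℝ) → ℝ) → ℝ := fun L s Φ => ∑ τ, w L τ * ∫ z, Φ (fun x => s * ((τ x : ℤ) : ℝ) + Real.sqrt s * z x) ∂(Measure.pi fun _ : ↥(Literature.Probability.LatticeModels.box 3 L) => ProbabilityTheory.gaussianReal 0 1); let σ2 : ℕ → ℝ := fun L => Literature.Probability.LatticeModels.plusExpect 3 βc 0 (fun σ => (∑ x ∈ Literature.Probability.LatticeModels.box 3 L, Literature.Probability.LatticeModels.spinAt x σ) ^ 2); ∃ a b c₂ : ℝ, 0 < a ∧ a < b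 ∧ b < 1 ∧ 0 < c₂ ∧ ∃ L₀ : ℕ, ∀ L ≥ L₀, ∀ s : ℝ, 0 ≤ s → a * σ2 L ≤ P L s (fun y => m L y ^ 2) → P L s (fun y => m L y ^ 2) ≤ b * σ2 L → P L s (fun y => r L y * m L y ^ 2) - P L s (r L) * P L s (fun y => m L y ^ 2) ≤ -(c₂ * (Real.sqrt (P L s (fun y => r L y ^ 2) - P L s (r L) ^ 2) * Real.sqrt (P L s (fun y => m L y ^ 4) - P L s (fun y => m L y ^ 2) ^ 2)))

/-- (N) NON-SELF-AVERAGING of the clock rate on every window (Aharony–Harris): `c₁·E r ≤ sd r`. [cite: AharonyHarris1996, abstract: no self-averaging when the randomness is relevant] -/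
def WindowNonSelfAveraging : Prop :=
  let βc : ℝ := Literature.Probability.LatticeModels.criticalBeta 3; let w : (L : ℕ) → (↥(Literature.Probability.LatticeModels.box 3 L) → ℤˣ) → ℝ := fun L τ => Literature.Probability.LatticeModels.plusExpect 3 βc 0 (fun σ => if (∀ x : ↥(Literature.Probability.LatticeModels.box 3 L), σ x = τ x) then 1 else 0); let tilt : (L : ℕ) → (↥(Literature.Probability.LatticeModels.box 3 L) → ℝ) → ((↥(Literature.Probability.LatticeModels.box 3 L) → ℤˣ) → ℝ) → ℝ := fun L y g => (∑ τ, w L τ * g τ * Real.exp (∑ x, y x * ((τ x : ℤ) : ℝ))) / (∑ τ, w L τ * Real.exp (∑ x, y x * ((τ x : ℤ) : ℝ))); let m : (L : ℕ) → (↥(Literature.Probability.LatticeModels.box 3 L) → ℝ) → ℝ := fun L y => tilt L y (fun τ => ∑ x, ((τ x : ℤ) : ℝ)); let Af : (L : ℕ) → (↥(Literature.Probability.LatticeModels.box 3 L) → ℝ) → ↥(Literature.Probability.LatticeModels.box 3 L) → ℝ := fun L y x => tilt L y (fun τ => ((τ x : ℤ) : ℝ) * ∑ x', ((τ x' : ℤ)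 : ℝ)) - tilt L y (fun τ => ((τ x : ℤ) : ℝ)) * m L y; let r : (L : ℕ) → (↥(Literature.Probability.LatticeModels.box 3 L) → ℝ) → ℝ := fun L y => ∑ x, Af L y x ^ 2; let P : (L : ℕ) → ℝ → ((↥(Literature.Probability.LatticeModels.box 3 L) → ℝ) → ℝ) → ℝ := fun L s Φ => ∑ τ, w L τ * ∫ z, Φ (fun x => s * ((τ x : ℤ) : ℝ) + Real.sqrt s * z x) ∂(Measure.pi fun _ : ↥(Literature.Probability.LatticeModels.box 3 L) => ProbabilityTheory.gaussianReal 0 1); let σ2 : ℕ → ℝ := fun L => Literature.Probability.LatticeModels.plusExpect 3 βc 0 (fun σ => (∑ x ∈ Literature.Probability.LatticeModels.box 3 L, Literature.Probability.LatticeModels.spinAt x σ) ^ 2); ∀ a b : ℝ, 0 < a → a < b → b < 1 → ∃ c₁ : ℝ, 0 < c₁ ∧ ∃ L₀ : ℕ, ∀ L ≥ L₀, ∀ s : ℝ, 0 ≤ s → a * σ2 L ≤ P L s (fun y => m L y ^ 2) → P L s (fun y => m L y ^ 2) ≤ b * σ2 L → c₁ * |P L s (r L)| ≤ Real.sqrt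 (P L s (fun y => r L y ^ 2) - P L s (r L) ^ 2)

/-- (W) SPREAD of the squared polarisation on every window: `c₃·E m² ≤ sd m²`. [folklore] -/
def WindowSpread : Prop :=
  let βc : ℝ := Literature.Probability.LatticeModels.criticalBeta 3; let w : (L : ℕ) → (↥(Literature.Probability.LatticeModels.box 3 L) → ℤˣ) → ℝ := fun L τ => Literature.Probability.LatticeModels.plusExpect 3 βc 0 (fun σ => if (∀ x : ↥(Literature.Probability.LatticeModels.box 3 L), σ x = τ x) then 1 else 0); let tilt : (L : ℕ) → (↥(Literature.Probability.LatticeModels.box 3 L) → ℝ) → ((↥(Literature.Probability.LatticeModels.box 3 L) → ℤˣ) → ℝ) → ℝ := fun L y g => (∑ τ, w L τ * g τ * Real.exp (∑ x, y x * ((τ x : ℤ) : ℝ))) / (∑ τ, w L τ * Real.exp (∑ x, y x * ((τ x : ℤ) : ℝ))); let m : (L : ℕ) → (↥(Literature.Probability.LatticeModels.box 3 L) → ℝ) → ℝ := fun L y => tilt L y (fun τ => ∑ x, ((τ x : ℤ) : ℝ)); let Af : (L : ℕ) → (↥(Literature.Probability.LatticeModels.box 3 L) → ℝ) → ↥(Literature.Probability.LatticeModels.box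 3 L) → ℝ := fun L y x => tilt L y (fun τ => ((τ x : ℤ) : ℝ) * ∑ x', ((τ x' : ℤ) : ℝ)) - tilt L y (fun τ => ((τ x : ℤ) : ℝ)) * m L y; let r : (L : ℕ) → (↥(Literature.Probability.LatticeModels.box 3 L) → ℝ) → ℝ := fun L y => ∑ x, Af L y x ^ 2; let P : (L : ℕ) → ℝ → ((↥(Literature.Probability.LatticeModels.box 3 L) → ℝ) → ℝ) → ℝ := fun L s Φ => ∑ τ, w L τ * ∫ z, Φ (fun x => s * ((τ x : ℤ) : ℝ) + Real.sqrt s * z x) ∂(Measure.pi fun _ : ↥(Literature.Probability.LatticeModels.box 3 L) => ProbabilityTheory.gaussianReal 0 1); let σ2 : ℕ → ℝ := fun L => Literature.Probability.LatticeModels.plusExpect 3 βc 0 (fun σ => (∑ x ∈ Literature.Probability.LatticeModels.box 3 L, Literature.Probability.LatticeModels.spinAt x σ) ^ 2); ∀ a b : ℝ, 0 < a → a < b → b < 1 → ∃ c₃ : ℝ, 0 < c₃ ∧ ∃ L₀ : ℕ, ∀ L ≥ L₀, ∀ s : ℝ, 0 ≤ s → a * σ2 L ≤ P L s (fun y =>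 m L y ^ 2) → P L s (fun y => m L y ^ 2) ≤ b * σ2 L → c₃ * |P L s (fun y => m L y ^ 2)| ≤ Real.sqrt (P L s (fun y => m L y ^ 4) - P L s (fun y => m L y ^ 2) ^ 2)

/-- S⁺ (STRENGTHENING, uniform shape bound on the whole clock): for all large `L` and EVERY `s ≥ 0`,
`Cov ≤ -c·q(1−q)·|E r·E m²|` with `q = P[m²]/σ_L²`, written division-free (times `σ_L⁴`). [folklore] -/
def WindowProfile : Prop :=
  let βc : ℝ := Literature.Probability.LatticeModels.criticalBeta 3; let w : (L : ℕ) → (↥(Literature.Probability.LatticeModels.box 3 L) → ℤˣ) → ℝ := fun L τ => Literature.Probability.LatticeModels.plusExpect 3 βc 0 (fun σ => if (∀ x : ↥(Literature.Probability.LatticeModels.box 3 L), σ x = τ x) then 1 else 0); let tilt : (L : ℕ) → (↥(Literature.Probability.LatticeModels.box 3 L) → ℝ) → ((↥(Literature.Probability.LatticeModels.box 3 L) → ℤˣ) → ℝ) → ℝ := fun L y g => (∑ τ, w L τ * g τ * Real.exp (∑ x, y x * ((τ x : ℤ) : ℝ))) / (∑ τ, w L τ * Real.exp (∑ x, y x *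 ((τ x : ℤ) : ℝ))); let m : (L : ℕ) → (↥(Literature.Probability.LatticeModels.box 3 L) → ℝ) → ℝ := fun L y => tilt L y (fun τ => ∑ x, ((τ x : ℤ) : ℝ)); let Af : (L : ℕ) → (↥(Literature.Probability.LatticeModels.box 3 L) → ℝ) → ↥(Literature.Probability.LatticeModels.box 3 L) → ℝ := fun L y x => tilt L y (fun τ => ((τ x : ℤ) : ℝ) * ∑ x', ((τ x' : ℤ) : ℝ)) - tilt L y (fun τ => ((τ x : ℤ) : ℝ)) * m L y; let r : (L : ℕ) → (↥(Literature.Probability.LatticeModels.box 3 L) → ℝ) → ℝ := fun L y => ∑ x, Af L y x ^ 2; let P : (L : ℕ) → ℝ → ((↥(Literature.Probability.LatticeModels.box 3 L) → ℝ) → ℝ) → ℝ := fun L s Φ => ∑ τ, w L τ * ∫ z, Φ (fun x => s * ((τ x : ℤ) : ℝ) + Real.sqrt s * z x) ∂(Measure.pi fun _ : ↥(Literature.Probability.LatticeModels.box 3 L) => ProbabilityTheory.gaussianReal 0 1); let σ2 : ℕ → ℝ := fun L => Literature.Probability.LatticeModels.plusExpect 3 βc 0 (fun σ => (∑ x ∈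 Literature.Probability.LatticeModels.box 3 L, Literature.Probability.LatticeModels.spinAt x σ) ^ 2); ∃ c : ℝ, 0 < c ∧ ∃ L₀ : ℕ, ∀ L ≥ L₀, 0 < σ2 L ∧ ∀ s : ℝ, 0 ≤ s → (P L s (fun y => r L y * m L y ^ 2) - P L s (r L) * P L s (fun y => m L y ^ 2)) * σ2 L ^ 2 ≤ -(c * (P L s (fun y => m L y ^ 2) * (σ2 L - P L s (fun y => m L y ^ 2))) * |P L s (r L) * P L s (fun y => m L y ^ 2)|)

end Sig

/-! ## Recompositions (kernel-checked, no `sorry`) -/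

/-- (A) ∧ (N) ∧ (W) ⇒ crux, with `c = c₂c₁c₃` on (A)'s window. [folklore] -/
theorem ImryMaWindowNoise_of_ANW :
    Sig.WindowAlignment → Sig.WindowNonSelfAveraging → Sig.WindowSpread → Summit.CriticalPhenomena.Ising3DConformalLimit.Theses.LocalisationClock.ImryMaWindowNoise := by
  intro hA hN hW
  obtain ⟨a, b, c₂, ha, hab, hb, hc₂, L₁, HA⟩ := hA
  obtain ⟨c₁, hc₁, L₂, HN⟩ := hN a b ha hab hb
  obtain ⟨c₃, hc₃, L₃, HW⟩ := hW a b ha hab hb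
  unfold Summit.CriticalPhenomena.Ising3DConformalLimit.Theses.LocalisationClock.ImryMaWindowNoise
  intro βc w tilt m Af r P σ2
  refine ⟨a, b, c₂ * (c₁ * c₃), ha, hab, hb, by positivity, max L₁ (max L₂ L₃), ?_⟩
  intro L hL s hs h1 h2
  have hL₁ : L₁ ≤ L := le_trans (le_max_left _ _) hL
  have hL₂ : L₂ ≤ L := le_trans ((le_max_left _ _).trans (le_max_right _ _)) hL
  have hL₃ : L₃ ≤ L := le_trans ((le_max_right _ _).trans (le_max_right _ _)) hL
  exact cov_le_of_corr_sd hc₁ hc₂ hc₃ (HA L hL₁ s hs h1 h2) (HN L hL₂ s hs h1 h2) (HW L hL₃ s hs h1 h2)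

/-- S⁺ ⇒ crux, with `a = 1/3`, `b = 2/3`, `c' = c/9`. [folklore] -/
theorem ImryMaWindowNoise_of_profile : Sig.WindowProfile → Summit.CriticalPhenomena.Ising3DConformalLimit.Theses.LocalisationClock.ImryMaWindowNoise := by
  intro hP
  obtain ⟨c, hc, L₀, H⟩ := hP
  unfold Summit.CriticalPhenomena.Ising3DConformalLimit.Theses.LocalisationClock.ImryMaWindowNoise
  intro βc w tilt m Af r P σ2
  refine ⟨1 / 3, 2 / 3, c / 9, by norm_num, by norm_num, by norm_num, by positivity, L₀, ?_⟩
  intro L hL s hs h1 h2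
  obtain ⟨hσ, H'⟩ := H L hL
  exact profile_core hc hσ h1 h2 (H' s hs)

end Summit.CriticalPhenomena.Ising3DConformalLimit.Cruxes.ImryMaWindowNoise.Census

end
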